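import Summits.ABC.ABC.Theorems.RibetTakahashiSplitFewPrimeValuationProductStubDecisivePrimeBootstrapLemmas
import HarnessLib

/-!
# The hard core: the `2`-exponent is polylogarithmic (sub-goal `hardCore_of_lfl_of_hardCoreXYZ`)

Helper (`--supports`) for the line `matveev-face-clearing` of the crux
`Summit.ABC.ABC.Theses.RibetTakahashiSplit.FewPrimeValuationProduct` (stmt-ABC-1563): the
registered sub-goal `hardCore_of_lfl_of_hardCoreXYZ`.

A *hard-core solution* is a solution of `±p^x ± q^y ± 2^k r^z = 0` in pairwise distinct odd
primes `p, q, r` with `x, y, z, k ≥ 1`, i.e. an abc triple `{p^x, q^y, 2^k r^z}`; its radical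
divides `R = 2pqr`. The hard-core bound of the line asks for `x·y·z·k ≤ C_ε R^ε`; this file shows
that, granted the LFL input `∃ K ≥ 1, PastenApproximationBound K` (Matveev + Yu over `ℚ` in
Pasten's form), it follows from the same bound for `x·y·z` only: the `2`-exponent `k` is always
`≤ C(K) Λ⁵`, `Λ = max(log R, 1)`.

Proof. Put the even member `2^k r^z` as `c` (case `p^x + q^y = 2^k r^z`) or as `a` (the two
other cases) and apply Yu's `2`-adic clause of the approximation bound at threshold `0`
(`Pasten.padic_bound_c` / `Pasten.padic_bound_a`):
`k · log 2 < Θ · (2/log 2)(log 2 + Y)` with `Y = log max{e, 2 log c}` and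
`Θ = theta K p^x q^y 0 ≤ K⁵ Λ⁴` (`decisivePrimeBootstrap_theta_zero_le`; the primes of `p^x q^y`
are `p, q ≤ R`). The a-priori bound `log c ≤ κ rad^{1/3} (log rad)³` (Stewart–Yu, from the same
input, `Literature.Barriers.ABC.bakerShapeBound_third_three_of_approximationBound`) and
`rad ≤ 2pqr` give `Y ≤ C_Y Λ` (`decisivePrimeBootstrap_log_max_le`), so `k ≤ 9 K⁵ C_Y Λ⁵`
(`decisivePrimeBootstrap_two_adic_numerics`); finally `Λ⁵ ≤ D R^{ε/2}`
(`decisivePrimeBootstrap_polylog_le_rpow`) and the `x·y·z`-bound at `ε/2`.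
-/

-- `Summit.ABC.ABC` is the mandated summit-side namespace (CONVENTIONS §2); the duplicate is
-- deliberate.
set_option linter.dupNamespace false

noncomputable section

namespace Summit.ABC.ABC.Theorems.FewPrimeValuationProduct

open Finset Real
open Literature.NumberTheory.DiophantineGeometry
open Literature.NumberTheory.DiophantineGeometry.Dioph
open Literature.NumberTheory.DiophantineGeometry.Pasten

/-! ## Arithmetic of a hard-core solution -/

/-- The `2`-exponent of `2^k r^z` is `k` for `r` odd. `[folklore]` -/
theorem hardCoreOfXYZ_factorization_two {r z k : ℕ} (hr : Odd r) :
    (2 ^ k * r ^ z).factorization 2 = k := by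
  rw [Nat.factorization_mul (pow_ne_zero _ two_ne_zero) (pow_ne_zero _ hr.pos.ne'),
    Finsupp.add_apply, Nat.Prime.factorization_pow Nat.prime_two, Finsupp.single_eq_same,
    Nat.factorization_eq_zero_of_not_dvd hr.pow.not_two_dvd_nat, add_zero]

/-- `p^x q^y (2^k r^z)` divides `(2pqr)^{x+y+z+k}`. `[folklore]` -/
theorem hardCoreOfXYZ_dvd_pow (p q r x y z k : ℕ) :
    p ^ x * q ^ y * (2 ^ k * r ^ z) ∣ (2 * p * q * r) ^ (x + y + z + k) := by
  have h : (2 * p * q * r) ^ (x + y + z + k) = p ^ (x + y + z + k) * q ^ (x + y + z + k) *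
      (2 ^ (x + y + z + k) * r ^ (x + y + z + k)) := by ring
  rw [h]
  exact mul_dvd_mul (mul_dvd_mul (pow_dvd_pow p (by omega)) (pow_dvd_pow q (by omega)))
    (mul_dvd_mul (pow_dvd_pow 2 (by omega)) (pow_dvd_pow r (by omega)))

/-- If `abc ∣ M^N` (`abc, M ≠ 0`) then `rad(abc) ≤ M` (`rad(abc) ∣ M`). `[folklore]` -/
theorem hardCoreOfXYZ_rad_le {a b c M N : ℕ} (h0 : a * b * c ≠ 0) (hM : M ≠ 0)
    (hdvd : a * b * c ∣ M ^ N) : rad a b c ≤ M := by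
  rw [rad_def]
  exact Nat.le_of_dvd (Nat.pos_of_ne_zero hM)
    ((UniqueFactorizationMonoid.exists_dvd_pow_iff_radical_dvd h0).mp ⟨N, hdvd⟩)

/-- Pasten's `Θ` at threshold `0` for the pair `(p^x, q^y)` (`p ≠ q` primes `≤ R`, `x, y ≥ 1`):
`theta K p^x q^y 0 ≤ K⁵ Λ⁴`, `Λ = max(log R, 1)`. `[folklore]` -/
theorem hardCoreOfXYZ_theta_le {K R : ℝ} (hK : 1 ≤ K) {p q x y : ℕ} (hp : p.Prime)
    (hq : q.Prime) (hpq : p ≠ q) (hx : x ≠ 0) (hy : y ≠ 0) (hpR : (p : ℝ) ≤ R)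
    (hqR : (q : ℝ) ≤ R) :
    theta K (p ^ x) (q ^ y) 0 ≤ K ^ 5 * (max (Real.log R) 1) ^ 4 := by
  have hp0 : p ^ x ≠ 0 := pow_ne_zero _ hp.ne_zero
  have hq0 : q ^ y ≠ 0 := pow_ne_zero _ hq.ne_zero
  have hcop : (p ^ x).Coprime (q ^ y) :=
    Nat.Coprime.pow x y ((Nat.coprime_primes hp hq).mpr hpq)
  have hpf : (p ^ x * q ^ y).primeFactors = {p} ∪ {q} := by
    rw [Nat.primeFactors_mul hp0 hq0, Nat.primeFactors_prime_pow hx hp,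
      Nat.primeFactors_prime_pow hy hq]
  refine decisivePrimeBootstrap_theta_zero_le hK (le_max_right _ _) hp0 hq0 hcop ?_ ?_
  · rw [hpf]
    exact (Finset.card_union_le _ _).trans (by simp)
  · intro ℓ hℓ
    rw [hpf, Finset.mem_union, Finset.mem_singleton, Finset.mem_singleton] at hℓ
    have hℓR : (0 : ℝ) < ℓ ∧ (ℓ : ℝ) ≤ R := by
      rcases hℓ with rfl | rfl
      · exact ⟨by exact_mod_cast hp.pos, hpR⟩
      · exact ⟨by exact_mod_cast hq.pos, hqR⟩
    exact (Real.log_le_log hℓR.1 hℓR.2).trans (le_max_left _ _)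

/-! ## The analytic inputs -/

/-- `Y = log max{e, 2 log c} ≤ C_Y Λ` with `Λ = max(log R, 1)`, from the Stewart–Yu a-priori
bound `log c ≤ κ rad^{1/3} (log rad)³` and `1 ≤ rad ≤ R`; `C_Y = 5 + log(2 max(κ⁺, 1))`.
`[folklore]` -/
theorem hardCoreOfXYZ_log_max_le {κ y Rr R : ℝ} (hRr : 1 ≤ Rr) (hRrR : Rr ≤ R)
    (hy : y ≤ κ * Rr ^ (1 / 3 : ℝ) * Real.log Rr ^ 3) :
    Real.log (max (Real.exp 1) (2 * y)) ≤
      (5 + Real.log (2 * max (max κ 0) 1)) * max (Real.log R) 1 := by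
  refine decisivePrimeBootstrap_log_max_le (hRr.trans hRrR) ?_
  have hRr0 : 0 < Rr := by linarith
  have hlog0 : 0 ≤ Real.log Rr := Real.log_nonneg hRr
  have hlog : Real.log Rr ^ 3 ≤ Real.log R ^ 3 :=
    pow_le_pow_left₀ hlog0 (Real.log_le_log hRr0 hRrR) 3
  have hrp0 : 0 ≤ Rr ^ (1 / 3 : ℝ) := Real.rpow_nonneg hRr0.le _
  have hrp : Rr ^ (1 / 3 : ℝ) ≤ R ^ (1 / 3 : ℝ) :=
    Real.rpow_le_rpow hRr0.le hRrR (by norm_num)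
  have hκ : κ ≤ max κ 0 := le_max_left _ _
  have hκ0 : 0 ≤ max κ 0 := le_max_right _ _
  calc y ≤ κ * Rr ^ (1 / 3 : ℝ) * Real.log Rr ^ 3 := hy
    _ ≤ max κ 0 * Rr ^ (1 / 3 : ℝ) * Real.log Rr ^ 3 :=
        mul_le_mul_of_nonneg_right (mul_le_mul_of_nonneg_right hκ hrp0) (pow_nonneg hlog0 3)
    _ ≤ max κ 0 * R ^ (1 / 3 : ℝ) * Real.log R ^ 3 :=
        mul_le_mul (mul_le_mul_of_nonneg_left hrp hκ0) hlog (pow_nonneg hlog0 3)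
          (mul_nonneg hκ0 (hrp0.trans hrp))

/-- **The `2`-exponent of a hard-core solution is polylogarithmic in the radical.** Granted
`PastenApproximationBound K` (`K ≥ 1`) and an a-priori bound `log c ≤ κ rad^{1/3} (log rad)³`
for all abc triples, every hard-core solution satisfies `k ≤ 9 K⁵ C_Y · max(log(2pqr), 1)⁵`,
`C_Y = 5 + log(2 max(κ⁺, 1))` (Yu's `2`-adic clause at the prime `2`, threshold `0`).
`[folklore]` -/
theorem hardCoreOfXYZ_two_exp_le {K κ : ℝ} (hK : 1 ≤ K) (hP : PastenApproximationBound K)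
    (hκ : ∀ a b c : ℕ, IsABCTriple a b c →
      Real.log c ≤ κ * (rad a b c : ℝ) ^ (1 / 3 : ℝ) * Real.log (rad a b c : ℕ) ^ 3)
    {p q r x y z k : ℕ} (hp : p.Prime) (hq : q.Prime) (hr : r.Prime) (hpo : Odd p)
    (hqo : Odd q) (hro : Odd r) (hpq : p ≠ q) (hpr : p ≠ r) (hqr : q ≠ r) (hx : 0 < x)
    (hy : 0 < y) (hk : 0 < k)
    (h : p ^ x + q ^ y = 2 ^ k * r ^ z ∨ p ^ x + 2 ^ k * r ^ z = q ^ y ∨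
      q ^ y + 2 ^ k * r ^ z = p ^ x) :
    (k : ℝ) ≤ 9 * K ^ 5 * (5 + Real.log (2 * max (max κ 0) 1)) *
      (max (Real.log ((2 * p * q * r : ℕ) : ℝ)) 1) ^ 5 := by
  set R : ℝ := ((2 * p * q * r : ℕ) : ℝ) with hRdef
  have hK0 : 0 ≤ K := zero_le_one.trans hK
  -- the odd primes are not `2`
  have hp2 : p ≠ 2 := by rintro rfl; exact (Nat.not_even_iff_odd.mpr hpo) even_two
  have hq2 : q ≠ 2 := by rintro rfl; exact (Nat.not_even_iff_odd.mpr hqo) even_two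
  -- positivity and coprimality of the three members
  have hpx : 0 < p ^ x := pow_pos hp.pos x
  have hqy : 0 < q ^ y := pow_pos hq.pos y
  have hw : 0 < 2 ^ k * r ^ z := mul_pos (pow_pos two_pos k) (pow_pos hr.pos z)
  have hcpq : (p ^ x).Coprime (q ^ y) :=
    Nat.Coprime.pow x y ((Nat.coprime_primes hp hq).mpr hpq)
  have hcwp : (2 ^ k * r ^ z).Coprime (p ^ x) :=
    Nat.Coprime.mul_left
      (Nat.Coprime.pow k x ((Nat.coprime_primes Nat.prime_two hp).mpr hp2.symm))
      (Nat.Coprime.pow z x ((Nat.coprime_primes hr hp).mpr hpr.symm))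
  have hcwq : (2 ^ k * r ^ z).Coprime (q ^ y) :=
    Nat.Coprime.mul_left
      (Nat.Coprime.pow k y ((Nat.coprime_primes Nat.prime_two hq).mpr hq2.symm))
      (Nat.Coprime.pow z y ((Nat.coprime_primes hr hq).mpr hqr.symm))
  -- the `2`-adic data of the even member
  have h2w : 2 ∣ 2 ^ k * r ^ z := dvd_mul_of_dvd_left (dvd_pow_self 2 hk.ne') _
  have hfac : (2 ^ k * r ^ z).factorization 2 = k := hardCoreOfXYZ_factorization_two hro
  -- the radical: `abc ∣ (2pqr)^N`, the primes `p, q ≤ 2pqr`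
  have hM0 : 2 * p * q * r ≠ 0 :=
    mul_ne_zero (mul_ne_zero (mul_ne_zero two_ne_zero hp.ne_zero) hq.ne_zero) hr.ne_zero
  have hMpos : 0 < 2 * p * q * r := Nat.pos_of_ne_zero hM0
  have hdvd := hardCoreOfXYZ_dvd_pow p q r x y z k
  have hpR : (p : ℝ) ≤ R := by
    rw [hRdef]; exact_mod_cast Nat.le_of_dvd hMpos ⟨2 * q * r, by ring⟩
  have hqR : (q : ℝ) ≤ R := by
    rw [hRdef]; exact_mod_cast Nat.le_of_dvd hMpos ⟨2 * p * r, by ring⟩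
  have hΘpq : theta K (p ^ x) (q ^ y) 0 ≤ K ^ 5 * (max (Real.log R) 1) ^ 4 :=
    hardCoreOfXYZ_theta_le hK hp hq hpq hx.ne' hy.ne' hpR hqR
  have hΘqp : theta K (q ^ y) (p ^ x) 0 ≤ K ^ 5 * (max (Real.log R) 1) ^ 4 :=
    hardCoreOfXYZ_theta_le hK hq hp hpq.symm hy.ne' hx.ne' hqR hpR
  rcases h with h1 | h2 | h3
  · -- `p^x + q^y = 2^k r^z`: the even member is `c`, `2`-adic clause at `p₀ = 2 ∣ c`
    have habc : IsABCTriple (p ^ x) (q ^ y) (2 ^ k * r ^ z) := ⟨hpx, hqy, h1, hcpq⟩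
    have hab1 : 1 < p ^ x * q ^ y :=
      calc 1 < 2 * 2 := by norm_num
        _ ≤ p ^ x * q ^ y := Nat.mul_le_mul (hp.two_le.trans (Nat.le_self_pow hx.ne' p))
            (hq.two_le.trans (Nat.le_self_pow hy.ne' q))
    have h0 : p ^ x * q ^ y * (2 ^ k * r ^ z) ≠ 0 :=
      mul_ne_zero (mul_ne_zero hpx.ne' hqy.ne') hw.ne'
    have hrad : ((rad (p ^ x) (q ^ y) (2 ^ k * r ^ z) : ℕ) : ℝ) ≤ R := by
      rw [hRdef]; exact_mod_cast hardCoreOfXYZ_rad_le h0 hM0 hdvd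
    have hY := hardCoreOfXYZ_log_max_le (Literature.Barriers.ABC.one_le_rad_real _ _ _) hrad
      (hκ _ _ _ habc)
    have key := decisivePrimeBootstrap_two_adic_numerics (theta_nonneg hK0 _ _ 0) hΘpq
      (one_le_log_max_exp _) hY (Nat.cast_nonneg _)
      (padic_bound_c hK hP habc hab1 0 Nat.prime_two h2w)
    rwa [hfac] at key
  · -- `p^x + 2^k r^z = q^y`: the even member is `a`, `2`-adic clause at `p₀ = 2 ∣ a`
    have habc : IsABCTriple (2 ^ k * r ^ z) (p ^ x) (q ^ y) :=
      ⟨hw, hpx, (add_comm _ _).trans h2, hcwp⟩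
    have h0 : 2 ^ k * r ^ z * p ^ x * q ^ y ≠ 0 :=
      mul_ne_zero (mul_ne_zero hw.ne' hpx.ne') hqy.ne'
    have hdvd' : 2 ^ k * r ^ z * p ^ x * q ^ y ∣ (2 * p * q * r) ^ (x + y + z + k) := by
      rw [show 2 ^ k * r ^ z * p ^ x * q ^ y = p ^ x * q ^ y * (2 ^ k * r ^ z) by ring]
      exact hdvd
    have hrad : ((rad (2 ^ k * r ^ z) (p ^ x) (q ^ y) : ℕ) : ℝ) ≤ R := by
      rw [hRdef]; exact_mod_cast hardCoreOfXYZ_rad_le h0 hM0 hdvd'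
    have hY := hardCoreOfXYZ_log_max_le (Literature.Barriers.ABC.one_le_rad_real _ _ _) hrad
      (hκ _ _ _ habc)
    have key := decisivePrimeBootstrap_two_adic_numerics (theta_nonneg hK0 _ _ 0) hΘpq
      (one_le_log_max_exp _) hY (Nat.cast_nonneg _)
      (padic_bound_a hK hP habc 0 Nat.prime_two h2w)
    rwa [hfac] at key
  · -- `q^y + 2^k r^z = p^x`: the even member is `a`, `2`-adic clause at `p₀ = 2 ∣ a`
    have habc : IsABCTriple (2 ^ k * r ^ z) (q ^ y) (p ^ x) :=
      ⟨hw, hqy, (add_comm _ _).trans h3, hcwq⟩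
    have h0 : 2 ^ k * r ^ z * q ^ y * p ^ x ≠ 0 :=
      mul_ne_zero (mul_ne_zero hw.ne' hqy.ne') hpx.ne'
    have hdvd' : 2 ^ k * r ^ z * q ^ y * p ^ x ∣ (2 * p * q * r) ^ (x + y + z + k) := by
      rw [show 2 ^ k * r ^ z * q ^ y * p ^ x = p ^ x * q ^ y * (2 ^ k * r ^ z) by ring]
      exact hdvd
    have hrad : ((rad (2 ^ k * r ^ z) (q ^ y) (p ^ x) : ℕ) : ℝ) ≤ R := by
      rw [hRdef]; exact_mod_cast hardCoreOfXYZ_rad_le h0 hM0 hdvd'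
    have hY := hardCoreOfXYZ_log_max_le (Literature.Barriers.ABC.one_le_rad_real _ _ _) hrad
      (hκ _ _ _ habc)
    have key := decisivePrimeBootstrap_two_adic_numerics (theta_nonneg hK0 _ _ 0) hΘqp
      (one_le_log_max_exp _) hY (Nat.cast_nonneg _)
      (padic_bound_a hK hP habc 0 Nat.prime_two h2w)
    rwa [hfac] at key

/-! ## The sub-goal -/

/-- **Sub-goal `hardCore_of_lfl_of_hardCoreXYZ` of the line `matveev-face-clearing`.** Granted
the LFL input `∃ K ≥ 1, PastenApproximationBound K` (Matveev + Yu over `ℚ` in Pasten's form), the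
hard-core bound with `x·y·z` implies the hard-core bound with `x·y·z·k`: for solutions of
`±p^x ± q^y ± 2^k r^z = 0` in distinct odd primes with positive exponents, the `2`-exponent `k`
is `≤ C(K) max(log 2pqr, 1)⁵` by Yu's `2`-adic clause (`hardCoreOfXYZ_two_exp_le`), and
`max(log R, 1)⁵ ≤ D_ε R^{ε/2}`. `[folklore]` -/
theorem hardCore_of_lfl_of_hardCoreXYZ :
    (∃ K : ℝ, 1 ≤ K ∧
      Literature.NumberTheory.DiophantineGeometry.Dioph.PastenApproximationBound K) →
    (∀ ε : ℝ, 0 < ε → ∃ C : ℝ, ∀ p q r x y z k : ℕ, p.Prime → q.Prime → r.Prime →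
      Odd p → Odd q → Odd r → p ≠ q → p ≠ r → q ≠ r → 0 < x → 0 < y → 0 < z → 0 < k →
      (p ^ x + q ^ y = 2 ^ k * r ^ z ∨ p ^ x + 2 ^ k * r ^ z = q ^ y ∨
        q ^ y + 2 ^ k * r ^ z = p ^ x) →
      ((x * y * z : ℕ) : ℝ) ≤ C * ((2 * p * q * r : ℕ) : ℝ) ^ ε) →
    ∀ ε : ℝ, 0 < ε → ∃ C : ℝ, ∀ p q r x y z k : ℕ, p.Prime → q.Prime → r.Prime →
      Odd p → Odd q → Odd r → p ≠ q → p ≠ r → q ≠ r → 0 < x → 0 < y → 0 < z → 0 < k →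
      (p ^ x + q ^ y = 2 ^ k * r ^ z ∨ p ^ x + 2 ^ k * r ^ z = q ^ y ∨
        q ^ y + 2 ^ k * r ^ z = p ^ x) →
      ((x * y * z * k : ℕ) : ℝ) ≤ C * ((2 * p * q * r : ℕ) : ℝ) ^ ε := by
  rintro ⟨K, hK, hP⟩ hxyz ε hε
  obtain ⟨κ, hκ⟩ :=
    Literature.Barriers.ABC.bakerShapeBound_third_three_of_approximationBound hK hP
  obtain ⟨C₀, hC₀⟩ := hxyz (ε / 2) (half_pos hε)
  obtain ⟨D, hD0, hD⟩ := decisivePrimeBootstrap_polylog_le_rpow 5 (half_pos hε)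
  set A : ℝ := 9 * K ^ 5 * (5 + Real.log (2 * max (max κ 0) 1)) with hAdef
  have hA0 : 0 ≤ A := by
    have h1 : 0 ≤ Real.log (2 * max (max κ 0) 1) :=
      Real.log_nonneg (by linarith [le_max_right (max κ 0) 1])
    have hK0 : 0 ≤ K := zero_le_one.trans hK
    rw [hAdef]
    exact mul_nonneg (by positivity) (by linarith)
  refine ⟨C₀ * A * D, ?_⟩
  intro p q r x y z k hp hq hr hpo hqo hro hpq hpr hqr hx hy hz hk h
  have hkA : (k : ℝ) ≤ A * (max (Real.log ((2 * p * q * r : ℕ) : ℝ)) 1) ^ 5 :=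
    hardCoreOfXYZ_two_exp_le hK hP hκ hp hq hr hpo hqo hro hpq hpr hqr hx hy hk h
  have h0 := hC₀ p q r x y z k hp hq hr hpo hqo hro hpq hpr hqr hx hy hz hk h
  set R : ℝ := ((2 * p * q * r : ℕ) : ℝ) with hRdef
  have hR1 : (1 : ℝ) ≤ R := by
    have hM0 : 2 * p * q * r ≠ 0 :=
      mul_ne_zero (mul_ne_zero (mul_ne_zero two_ne_zero hp.ne_zero) hq.ne_zero) hr.ne_zero
    rw [hRdef]; exact_mod_cast Nat.one_le_iff_ne_zero.mpr hM0
  have hR0 : (0 : ℝ) < R := by linarith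
  have hW0 : 0 ≤ C₀ * R ^ (ε / 2) := (Nat.cast_nonneg _).trans h0
  have hΛD : (max (Real.log R) 1) ^ 5 ≤ D * R ^ (ε / 2) := hD R hR1
  calc ((x * y * z * k : ℕ) : ℝ) = ((x * y * z : ℕ) : ℝ) * (k : ℝ) := by push_cast; ring
    _ ≤ C₀ * R ^ (ε / 2) * (A * (max (Real.log R) 1) ^ 5) :=
        mul_le_mul h0 hkA (Nat.cast_nonneg _) hW0
    _ ≤ C₀ * R ^ (ε / 2) * (A * (D * R ^ (ε / 2))) :=
        mul_le_mul_of_nonneg_left (mul_le_mul_of_nonneg_left hΛD hA0) hW0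
    _ = C₀ * A * D * (R ^ (ε / 2) * R ^ (ε / 2)) := by ring
    _ = C₀ * A * D * R ^ ε := by rw [← Real.rpow_add hR0, add_halves]

end Summit.ABC.ABC.Theorems.FewPrimeValuationProduct

end
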